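import Literature.Analysis.FluidPDE.LocalLerayInitialPairing
import Literature.Analysis.FluidPDE.CKNVelocityIntegrability
import Literature.Analysis.FluidPDE.NSSuitableESS
import HarnessLib

/-!
# Local Leray solutions: `|v|³` is integrable up to the initial time, with a rate on `(0, t) × B₁`

Analysis/FluidPDE proof file (no new definitions, no new named facts), support file of the
discharge of `Literature.Analysis.FluidPDE.bradshawTsai2019_limitDatum`
(`ForwardDSSCylinderLimitParts.lean`; Bradshaw–Tsai, Analysis & PDE 12 (2019) =
arXiv:1801.08060, §4.3, p. 12), complementing `LocalLerayInitialPairing.lean` (the weak form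
with the datum). The continuity of the limit at `t = 0` rests on the local energy
inequality *from the initial time*, whose cubic and pressure terms
`∫₀ᵗ ∫ (|v|² + 2π) v·∇φ` must be (i) meaningful for a local Leray solution down to `t = 0` and
(ii) small as `t → 0⁺` *uniformly* along a sequence with uniform local energy bounds
(Lemarié-Rieusset 2016, proof of Prop. 14.1 / Thm. 14.2; Bradshaw–Tsai 2019, p. 12: "`vₖ` are
uniformly bounded in `L^∞(0,T;L²(B₁)) ∩ L²(0,T;H¹(B₁))` (hence also in
`L^{10/3}(0,T;L^{10/3}(B₁))`)"). Both follow from the slice-wise Sobolev inequality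
`H¹(B) ⊂ L⁶(B)` and Lebesgue interpolation, as in the tree's `CKNVelocityIntegrability.lean`
(Lemarié-Rieusset 2016, (13.17)–(13.18)) and `CKNInterpolationEstimate.lean`
(Robinson–Rodrigo–Sadowski 2016, Lemma 15.10). This file proves:

* `lintegral_rpow_three_quarters_le_mul` — Hölder in time, `∫ f^{3/4} ≤ (∫ f)^{3/4} μ(univ)^{1/4}`;
* `exists_lintegral_cube_cylinder_le` — **the quantitative bound**: an absolute `K` with
  `∫∫_{(0,t) × B₁} |u|³ ≤ K C^{3/2} (t + t^{1/4})` for every `u` with a weak spatial gradient `G`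
  on `(0, T) × B₁`, `esssup_{0<s<T} ∫_{B₁} |u(s)|² ≤ C`, `∫∫_{(0,T)×B₁} |G|² ≤ C`, `0 < t ≤ T`;
* `IsLocalLeraySolution.integrableOn_block_zero` — `v`, `|v|²`, `π` are integrable on the blocks
  `(0, b) × K` *up to `t = 0`* (the clauses `v ∈ L²_loc`, `π ∈ L^{3/2}_loc(ℝ³ × [0, ∞))` of
  Kang–Miura–Tsai 2021, Def. 3.1/3.2);
* `IsLocalLeraySolution.lintegral_rpow_ten_thirds_block_lt_top`,
  `IsLocalLeraySolution.lintegral_cube_block_lt_top`,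
  `IsLocalLeraySolution.integrableOn_cube_block_zero`,
  `IsLocalLeraySolution.locallyIntegrableOn_cube` — for a local Leray solution
  (Kang–Miura–Tsai 2021, Def. 3.2) `|v|^{10/3}` and `|v|³` are integrable on every block
  `(0, T) × K` up to `t = 0` (clause (2) of the definition and (13.18) on a large cylinder
  `(0, R²) × B_R ⊇ (0, T) × K`), in particular `|v|³ ∈ L¹_loc` of the open slab;
* `IsLocalLeraySolution.integrableOn_abs_pressure_rpow_block_zero`,
  `IsLocalLeraySolution.integrableOn_cubicFlux_block_zero` — `|π|^{3/2}` and the flux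
  `(|v|² + 2π) v` are integrable on the blocks up to `t = 0` (Young's inequality).

## Mathlib / tree search

Tree: `integrableOn_cylinder_of_lintegral_sq`, `volume_Ioo_prod_lt_top`
(`DistributionalToWeak.lean`), `exists_eLpNorm_six_le_unitBall`, `lintegral_pow_three_le_Lp_interpolation`
(`CKNInterpolationEstimate.lean`), `lintegral_rpow_ten_thirds_lt_top_of_energy`
(`CKNVelocityIntegrability.lean`), `HasWeakSpatialGradientOn.ae_hasWeakFDerivOn_slice`
(`WeakGradientSlicing.lean`), `continuous_frobeniusNormSq'`, `timeCylinder`, `unitBall`.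
Mathlib: `ENNReal.lintegral_mul_le_Lp_mul_Lq`, `ENNReal.rpow_add_le_add_rpow`,
`Real.young_inequality_of_nonneg`.

## References

* P. G. Lemarié-Rieusset, *The Navier–Stokes problem in the 21st century*, CRC Press (2016),
  (13.17)–(13.18) p. 461; Prop. 14.1. [LemarieRieusset2016]
* J. C. Robinson, J. L. Rodrigo, W. Sadowski, *The three-dimensional Navier–Stokes equations*,
  CUP (2016), Lemma 3.5, Lemma 15.10. [RobinsonRodrigoSadowski2016]
* Z. Bradshaw, T.-P. Tsai, Analysis & PDE 12 (2019) = arXiv:1801.08060, §4.3, p. 12.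
  [BradshawTsai2019]
-/

noncomputable section

open MeasureTheory Set Function Filter Topology TopologicalSpace Metric Module
open scoped NNReal ENNReal InnerProductSpace RealInnerProductSpace

namespace Literature.Analysis.FluidPDE

/-! ### Hölder in time with the measure of the time set -/

section Holder

variable {α : Type*} [MeasurableSpace α]

/-- Hölder in time against the constant `1`: `∫ f^{3/4} ≤ (∫ f)^{3/4} μ(univ)^{1/4}`. [folklore] -/
theorem lintegral_rpow_three_quarters_le_mul (μ : Measure α) {f : α → ℝ≥0∞}
    (hf : AEMeasurable f μ) :
    ∫⁻ x, f x ^ (3 / 4 : ℝ) ∂μ ≤ (∫⁻ x, f x ∂μ) ^ (3 / 4 : ℝ) * μ univ ^ (1 / 4 : ℝ) := by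
  have hpq : (4 / 3 : ℝ).HolderConjugate 4 := Real.holderConjugate_iff.2 ⟨by norm_num, by norm_num⟩
  have key := ENNReal.lintegral_mul_le_Lp_mul_Lq μ hpq (hf.pow_const (3 / 4 : ℝ))
    (g := fun _ => 1) aemeasurable_const
  have h2 : ∀ x, (f x ^ (3 / 4 : ℝ)) ^ (4 / 3 : ℝ) = f x := fun x => by
    rw [← ENNReal.rpow_mul, show (3 / 4 : ℝ) * (4 / 3) = 1 by norm_num, ENNReal.rpow_one]
  simp only [Pi.mul_apply, mul_one, h2, ENNReal.one_rpow, lintegral_const, one_mul] at key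
  rw [show (1 : ℝ) / (4 / 3) = 3 / 4 by norm_num] at key
  exact key

/-- The algebra of the final bound: `C^{3/4} ((C s + C)^{3/4} s^{1/4}) ≤ C^{3/2} (s + s^{1/4})`
in `ℝ≥0∞` (subadditivity of `x ↦ x^{3/4}`). [folklore] -/
theorem rpow_three_quarters_bound_aux (C s : ℝ≥0∞) :
    C ^ (3 / 4 : ℝ) * ((C * s + C) ^ (3 / 4 : ℝ) * s ^ (1 / 4 : ℝ)) ≤
      C ^ (3 / 2 : ℝ) * (s + s ^ (1 / 4 : ℝ)) := by
  have hsub : (C * s + C) ^ (3 / 4 : ℝ) ≤ (C * s) ^ (3 / 4 : ℝ) + C ^ (3 / 4 : ℝ) :=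
    ENNReal.rpow_add_le_add_rpow _ _ (by norm_num) (by norm_num)
  have hCC : C ^ (3 / 4 : ℝ) * C ^ (3 / 4 : ℝ) = C ^ (3 / 2 : ℝ) := by
    rw [← ENNReal.rpow_add_of_nonneg _ _ (by norm_num) (by norm_num)]; norm_num
  have hss : s ^ (3 / 4 : ℝ) * s ^ (1 / 4 : ℝ) = s := by
    rw [← ENNReal.rpow_add_of_nonneg _ _ (by norm_num) (by norm_num)]; norm_num
  calc C ^ (3 / 4 : ℝ) * ((C * s + C) ^ (3 / 4 : ℝ) * s ^ (1 / 4 : ℝ))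
      ≤ C ^ (3 / 4 : ℝ) * (((C * s) ^ (3 / 4 : ℝ) + C ^ (3 / 4 : ℝ)) * s ^ (1 / 4 : ℝ)) := by
        gcongr
    _ = C ^ (3 / 4 : ℝ) * C ^ (3 / 4 : ℝ) * (s ^ (3 / 4 : ℝ) * s ^ (1 / 4 : ℝ)) +
          C ^ (3 / 4 : ℝ) * C ^ (3 / 4 : ℝ) * s ^ (1 / 4 : ℝ) := by
        rw [ENNReal.mul_rpow_of_nonneg _ _ (by norm_num)]
        ring
    _ = C ^ (3 / 2 : ℝ) * (s + s ^ (1 / 4 : ℝ)) := by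
        rw [hCC, hss]
        ring

end Holder

/-! ### The quantitative cubic bound on `(0, t) × B₁` -/

section Cube

/-- **`∫∫_{(0,t) × B₁} |u|³ ≤ K C^{3/2} (t + t^{1/4})`** (Lemarié-Rieusset 2016, (13.17)–(13.18)
and Prop. 14.1; Robinson–Rodrigo–Sadowski 2016, Lemma 15.10; the `L³` form of Bradshaw–Tsai's
"uniformly bounded in `L^∞L² ∩ L²H¹` (hence also in `L^{10/3}`)", p. 12). There is an absolute
constant `K` such that for every field `u` with a weak spatial gradient `G` on the cylinder
`(0, T) × B₁` satisfying `∫_{B₁} |u(s)|² ≤ C` for a.e. `s ∈ (0, T)` and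
`∫∫_{(0,T)×B₁} |G|² ≤ C`, and every `0 < t ≤ T`,
`∫∫_{(0,t)×B₁} |u|³ ≤ K C^{3/2} (t + t^{1/4})`. Proof: for a.e. `s`, `u(s)` has the weak derivative
`G(s)` on `B₁`, so by Lebesgue interpolation and the Sobolev inequality on `B₁`,
`∫_{B₁} |u(s)|³ ≤ (∫ |u(s)|²)^{3/4} ‖u(s)‖_{L⁶}^{3/2} ≤ C^{3/4} (2C_S)^{3/2} (a(s) + e(s))^{3/4}`;
Hölder in time gives `∫₀ᵗ (a + e)^{3/4} ≤ t^{1/4} (Ct + C)^{3/4}`. [cite: LemarieRieusset2016, (13.17)–(13.18) p. 461] -/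
theorem exists_lintegral_cube_cylinder_le :
    ∃ K : ℝ≥0, ∀ (u : ℝ → (EuclideanSpace ℝ (Fin 3)) → (EuclideanSpace ℝ (Fin 3))) (G : ℝ → (EuclideanSpace ℝ (Fin 3)) → (EuclideanSpace ℝ (Fin 3)) →L[ℝ] (EuclideanSpace ℝ (Fin 3))) (T : ℝ) (C : ℝ≥0) (t : ℝ),
      HasWeakSpatialGradientOn (timeCylinder unitBall 0 T) u G →
      (∀ᵐ s ∂(volume.restrict (Ioo 0 T)), ∫⁻ x in ball (0 : (EuclideanSpace ℝ (Fin 3))) 1, ‖u s x‖ₑ ^ 2 ≤ C) →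
      ∫⁻ z in Ioo 0 T ×ˢ ball (0 : (EuclideanSpace ℝ (Fin 3))) 1, ENNReal.ofReal (frobeniusNormSq (G z.1 z.2)) ≤ C →
      0 < t → t ≤ T →
      ∫⁻ z in Ioo 0 t ×ˢ ball (0 : (EuclideanSpace ℝ (Fin 3))) 1, ‖u z.1 z.2‖ₑ ^ (3 : ℕ) ≤
        K * (C : ℝ≥0∞) ^ (3 / 2 : ℝ) * (ENNReal.ofReal t + ENNReal.ofReal (t ^ (1 / 4 : ℝ))) := by
  obtain ⟨CS, hCS⟩ := exists_eLpNorm_six_le_unitBall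
  refine ⟨(2 * CS) ^ (3 / 2 : ℝ), fun u G T C t h hE hGb ht htT => ?_⟩
  -- notation
  set B : Set (EuclideanSpace ℝ (Fin 3)) := ball 0 1 with hB
  set I : Set ℝ := Ioo 0 T with hI
  set J : Set ℝ := Ioo 0 t with hJ
  set a : ℝ → ℝ≥0∞ := fun s => ∫⁻ x in B, ‖u s x‖ₑ ^ 2 with ha
  set e : ℝ → ℝ≥0∞ := fun s => ∫⁻ x in B, ENNReal.ofReal (frobeniusNormSq (G s x)) with he
  set c : ℝ → ℝ≥0∞ := fun s => ∫⁻ x in B, ‖u s x‖ₑ ^ (3 : ℕ) with hc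
  have hJI : J ⊆ I := Ioo_subset_Ioo_right htT
  -- measurability on the cylinders
  have hQsub : I ×ˢ B ⊆ ((timeCylinder unitBall 0 T : Opens (ℝ × (EuclideanSpace ℝ (Fin 3)))) : Set (ℝ × (EuclideanSpace ℝ (Fin 3)))) :=
    fun z hz => hz
  have hum : AEStronglyMeasurable (uncurry u) (volume.restrict (I ×ˢ B)) :=
    (h.locallyIntegrableOn.mono_set hQsub).aestronglyMeasurable
  have hGm : AEStronglyMeasurable (uncurry G) (volume.restrict (I ×ˢ B)) :=
    (h.locallyIntegrableOn_grad.mono_set hQsub).aestronglyMeasurable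
  have humJ : AEStronglyMeasurable (uncurry u) (volume.restrict (J ×ˢ B)) :=
    hum.mono_measure (Measure.restrict_mono (prod_mono hJI Subset.rfl) le_rfl)
  have hprodI : (volume.restrict (I ×ˢ B) : Measure (ℝ × (EuclideanSpace ℝ (Fin 3)))) =
      (volume.restrict I).prod (volume.restrict B) := by
    rw [Measure.volume_eq_prod, Measure.prod_restrict]
  have hprodJ : (volume.restrict (J ×ˢ B) : Measure (ℝ × (EuclideanSpace ℝ (Fin 3)))) =
      (volume.restrict J).prod (volume.restrict B) := by
    rw [Measure.volume_eq_prod, Measure.prod_restrict]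
  have hum3 : AEMeasurable (fun q : ℝ × (EuclideanSpace ℝ (Fin 3)) => ‖u q.1 q.2‖ₑ ^ (3 : ℕ))
      ((volume.restrict J).prod (volume.restrict B)) := by
    rw [← hprodJ]; exact (humJ.enorm.pow_const 3)
  have hum2 : AEMeasurable (fun q : ℝ × (EuclideanSpace ℝ (Fin 3)) => ‖u q.1 q.2‖ₑ ^ (2 : ℕ))
      ((volume.restrict I).prod (volume.restrict B)) := by
    rw [← hprodI]; exact (hum.enorm.pow_const 2)
  have hGm2 : AEMeasurable (fun q : ℝ × (EuclideanSpace ℝ (Fin 3)) => ENNReal.ofReal (frobeniusNormSq (G q.1 q.2)))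
      ((volume.restrict I).prod (volume.restrict B)) := by
    rw [← hprodI]
    exact (continuous_frobeniusNormSq'.comp_aestronglyMeasurable hGm).aemeasurable.ennreal_ofReal
  -- Tonelli
  have hEeq : ∫⁻ z in I ×ˢ B, ENNReal.ofReal (frobeniusNormSq (G z.1 z.2)) = ∫⁻ s in I, e s := by
    rw [Measure.volume_eq_prod, setLIntegral_prod _ (by rwa [← Measure.prod_restrict])]
  have hCeq : ∫⁻ z in J ×ˢ B, ‖u z.1 z.2‖ₑ ^ (3 : ℕ) = ∫⁻ s in J, c s := by
    rw [Measure.volume_eq_prod, setLIntegral_prod _ (by rwa [← Measure.prod_restrict])]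
  have ham : AEMeasurable a (volume.restrict I) := hum2.lintegral_prod_right'
  have hem : AEMeasurable e (volume.restrict I) := hGm2.lintegral_prod_right'
  have hamJ : AEMeasurable a (volume.restrict J) :=
    ham.mono_measure (Measure.restrict_mono hJI le_rfl)
  have hemJ : AEMeasurable e (volume.restrict J) :=
    hem.mono_measure (Measure.restrict_mono hJI le_rfl)
  -- a.e. in time: energy bound, finite dissipation, weak derivative of the slice
  have h1 : ∀ᵐ s ∂(volume.restrict I), a s ≤ C := hE
  have hEfin : ∫⁻ s in I, e s ≤ C := by rw [← hEeq]; exact hGb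
  have h2 : ∀ᵐ s ∂(volume.restrict I), e s < ∞ :=
    ae_lt_top' hem (ne_top_of_le_ne_top ENNReal.coe_ne_top hEfin)
  have h3 : ∀ᵐ s ∂(volume.restrict I),
      FunctionSpaces.HasWeakFDerivOn (unitBall : Opens (EuclideanSpace ℝ (Fin 3))) volume (u s) (G s) :=
    HasWeakSpatialGradientOn.ae_hasWeakFDerivOn_slice (Ω := (unitBall : Opens (EuclideanSpace ℝ (Fin 3)))) h
  -- the pointwise-in-time estimate
  set M : ℝ≥0∞ := ((2 * CS : ℝ≥0) : ℝ≥0∞) ^ (3 / 2 : ℝ) with hM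
  have hpt : ∀ᵐ s ∂(volume.restrict I),
      c s ≤ (C : ℝ≥0∞) ^ (3 / 4 : ℝ) * (M * (a s + e s) ^ (3 / 4 : ℝ)) := by
    filter_upwards [h1, h2, h3] with s has hes hws
    have has' : a s ≠ ∞ := ne_top_of_le_ne_top ENNReal.coe_ne_top has
    have hutm : AEStronglyMeasurable (u s) (volume.restrict B) :=
      hws.locallyIntegrableOn.aestronglyMeasurable
    -- `‖u s‖_{L²(B)} = a(s)^{1/2}`
    have hL2 : eLpNorm (u s) 2 (volume.restrict B) = a s ^ (1 / 2 : ℝ) := by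
      rw [eLpNorm_eq_lintegral_rpow_enorm_toReal two_ne_zero ENNReal.ofNat_ne_top,
        ENNReal.toReal_ofNat, ha]
      simp only [one_div]
      congr 1
      refine lintegral_congr fun x => ?_
      rw [show (2 : ℝ) = ((2 : ℕ) : ℝ) by norm_num, ENNReal.rpow_natCast]
    have hL2' : eLpNorm (u s) 2 (volume.restrict B) ≠ ∞ := by
      rw [hL2]; exact ENNReal.rpow_ne_top_of_nonneg (by norm_num) has'
    -- Sobolev on the slice
    have hS : eLpNorm (u s) 6 (volume.restrict B) ≤
        CS * (a s ^ (1 / 2 : ℝ) + e s ^ (1 / 2 : ℝ)) := by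
      have := hCS (u s) (G s) hws hL2'
      rwa [hL2] at this
    have hS2 : eLpNorm (u s) 6 (volume.restrict B) ≤
        ((2 * CS : ℝ≥0) : ℝ≥0∞) * (a s + e s) ^ (1 / 2 : ℝ) := by
      refine hS.trans ?_
      have h1' : a s ^ (1 / 2 : ℝ) ≤ (a s + e s) ^ (1 / 2 : ℝ) :=
        ENNReal.rpow_le_rpow le_self_add (by norm_num)
      have h2' : e s ^ (1 / 2 : ℝ) ≤ (a s + e s) ^ (1 / 2 : ℝ) :=
        ENNReal.rpow_le_rpow le_add_self (by norm_num)
      calc (CS : ℝ≥0∞) * (a s ^ (1 / 2 : ℝ) + e s ^ (1 / 2 : ℝ))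
          ≤ CS * ((a s + e s) ^ (1 / 2 : ℝ) + (a s + e s) ^ (1 / 2 : ℝ)) := by gcongr
        _ = ((2 * CS : ℝ≥0) : ℝ≥0∞) * (a s + e s) ^ (1 / 2 : ℝ) := by push_cast; ring
    -- `(∫ |u s|⁶)^{1/4} = ‖u s‖_{L⁶}^{3/2}`
    have hL6 : (∫⁻ x in B, ‖u s x‖ₑ ^ (6 : ℝ)) ^ (1 / 4 : ℝ) =
        eLpNorm (u s) 6 (volume.restrict B) ^ (3 / 2 : ℝ) := by
      rw [eLpNorm_eq_lintegral_rpow_enorm_toReal (by norm_num) ENNReal.ofNat_ne_top,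
        ENNReal.toReal_ofNat, ← ENNReal.rpow_mul]
      norm_num
    -- Hölder in space
    have hH := lintegral_pow_three_le_Lp_interpolation (volume.restrict B) hutm.enorm
    calc c s ≤ a s ^ (3 / 4 : ℝ) * (∫⁻ x in B, ‖u s x‖ₑ ^ (6 : ℝ)) ^ (1 / 4 : ℝ) := hH
      _ = a s ^ (3 / 4 : ℝ) * eLpNorm (u s) 6 (volume.restrict B) ^ (3 / 2 : ℝ) := by rw [hL6]
      _ ≤ (C : ℝ≥0∞) ^ (3 / 4 : ℝ) *
            (((2 * CS : ℝ≥0) : ℝ≥0∞) * (a s + e s) ^ (1 / 2 : ℝ)) ^ (3 / 2 : ℝ) := by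
          gcongr
      _ = (C : ℝ≥0∞) ^ (3 / 4 : ℝ) * (M * (a s + e s) ^ (3 / 4 : ℝ)) := by
          rw [hM, ENNReal.mul_rpow_of_nonneg _ _ (by norm_num), ← ENNReal.rpow_mul]
          norm_num
  have hptJ : ∀ᵐ s ∂(volume.restrict J),
      c s ≤ (C : ℝ≥0∞) ^ (3 / 4 : ℝ) * (M * (a s + e s) ^ (3 / 4 : ℝ)) :=
    ae_restrict_of_ae_restrict_of_subset hJI hpt
  -- integrate in time over `J = (0, t)`
  have hMtop : M ≠ ∞ := ENNReal.rpow_ne_top_of_nonneg (by norm_num) ENNReal.coe_ne_top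
  have hK : (C : ℝ≥0∞) ^ (3 / 4 : ℝ) * M ≠ ∞ :=
    ENNReal.mul_ne_top (ENNReal.rpow_ne_top_of_nonneg (by norm_num) ENNReal.coe_ne_top) hMtop
  have hvolJ : (volume.restrict J : Measure ℝ) univ = ENNReal.ofReal t := by
    rw [Measure.restrict_apply_univ, hJ, Real.volume_Ioo, sub_zero]
  have hint_a : ∫⁻ s in J, a s ≤ C * ENNReal.ofReal t := by
    calc ∫⁻ s in J, a s ≤ ∫⁻ _ in J, (C : ℝ≥0∞) :=
          lintegral_mono_ae (ae_restrict_of_ae_restrict_of_subset hJI h1)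
      _ = C * (volume.restrict J) univ := lintegral_const _
      _ = C * ENNReal.ofReal t := by rw [hvolJ]
  have hint_e : ∫⁻ s in J, e s ≤ C := (lintegral_mono_set hJI).trans hEfin
  have ht4 : ENNReal.ofReal t ^ (1 / 4 : ℝ) = ENNReal.ofReal (t ^ (1 / 4 : ℝ)) :=
    ENNReal.ofReal_rpow_of_nonneg ht.le (by norm_num)
  calc ∫⁻ z in J ×ˢ B, ‖u z.1 z.2‖ₑ ^ (3 : ℕ) = ∫⁻ s in J, c s := hCeq
    _ ≤ ∫⁻ s in J, (C : ℝ≥0∞) ^ (3 / 4 : ℝ) * (M * (a s + e s) ^ (3 / 4 : ℝ)) :=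
        lintegral_mono_ae hptJ
    _ = (C : ℝ≥0∞) ^ (3 / 4 : ℝ) * M * ∫⁻ s in J, (a s + e s) ^ (3 / 4 : ℝ) := by
        rw [← lintegral_const_mul' _ _ hK]
        refine lintegral_congr fun s => ?_
        ring
    _ ≤ (C : ℝ≥0∞) ^ (3 / 4 : ℝ) * M *
          ((∫⁻ s in J, (a s + e s)) ^ (3 / 4 : ℝ) * (volume.restrict J) univ ^ (1 / 4 : ℝ)) := by
        gcongr
        exact lintegral_rpow_three_quarters_le_mul _ (hamJ.add hemJ)
    _ ≤ (C : ℝ≥0∞) ^ (3 / 4 : ℝ) * M *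
          ((C * ENNReal.ofReal t + C) ^ (3 / 4 : ℝ) * ENNReal.ofReal t ^ (1 / 4 : ℝ)) := by
        rw [hvolJ]
        gcongr
        rw [lintegral_add_left' hamJ]
        exact add_le_add hint_a hint_e
    _ = M * ((C : ℝ≥0∞) ^ (3 / 4 : ℝ) *
          ((C * ENNReal.ofReal t + C) ^ (3 / 4 : ℝ) * ENNReal.ofReal t ^ (1 / 4 : ℝ))) := by ring
    _ ≤ M * ((C : ℝ≥0∞) ^ (3 / 2 : ℝ) * (ENNReal.ofReal t + ENNReal.ofReal t ^ (1 / 4 : ℝ))) :=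
        mul_le_mul' le_rfl (rpow_three_quarters_bound_aux _ _)
    _ = (((2 * CS) ^ (3 / 2 : ℝ) : ℝ≥0) : ℝ≥0∞) * (C : ℝ≥0∞) ^ (3 / 2 : ℝ) *
          (ENNReal.ofReal t + ENNReal.ofReal (t ^ (1 / 4 : ℝ))) := by
        rw [hM, ENNReal.coe_rpow_of_nonneg _ (by norm_num), ht4]
        ring

end Cube

/-! ### Local Leray solutions up to the initial time -/

namespace IsLocalLeraySolution

variable {ν : ℝ} {v₀ : (EuclideanSpace ℝ (Fin 3)) → (EuclideanSpace ℝ (Fin 3))} {v : ℝ → (EuclideanSpace ℝ (Fin 3)) → (EuclideanSpace ℝ (Fin 3))} {π : ℝ → (EuclideanSpace ℝ (Fin 3)) → ℝ}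

/-! #### Integrability of `v`, `|v|²`, `π` on blocks -/

/-- The blocks `(0, b) × K` lie in the open slab `(0, ∞) × ℝ³`. [folklore] -/
theorem Ioo_prod_subset_slab (b : ℝ) (K : Set (EuclideanSpace ℝ (Fin 3))) :
    Ioo (0 : ℝ) b ×ˢ K ⊆ ((slab (EuclideanSpace ℝ (Fin 3)) (Ioi 0) isOpen_Ioi : Opens (ℝ × (EuclideanSpace ℝ (Fin 3)))) : Set (ℝ × (EuclideanSpace ℝ (Fin 3)))) := by
  rw [coe_slab]
  exact prod_mono (fun t ht => ht.1) (subset_univ _)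

/-- A local Leray solution and its pressure are a.e.-strongly measurable on the blocks
`(0, b) × K` (they are locally integrable on the open slab). [folklore] -/
theorem aestronglyMeasurable_block (h : IsLocalLeraySolution ν v₀ v π) (b : ℝ) (K : Set (EuclideanSpace ℝ (Fin 3))) :
    AEStronglyMeasurable (uncurry v) (volume.restrict (Ioo 0 b ×ˢ K)) ∧
      AEStronglyMeasurable (uncurry π) (volume.restrict (Ioo 0 b ×ˢ K)) :=
  ⟨h.distributional.1.aestronglyMeasurable.mono_measure
      (Measure.restrict_mono (Ioo_prod_subset_slab b K) le_rfl),
    h.distributional.2.2.1.aestronglyMeasurable.mono_measure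
      (Measure.restrict_mono (Ioo_prod_subset_slab b K) le_rfl)⟩

/-- **Integrability up to `t = 0`.** For a local Leray solution, `v`, `|v|²` and `π` are
integrable on every block `(0, b) × K`, `K` compact: the clauses `v ∈ L²_loc(ℝ³ × [0, ∞))`,
`π ∈ L^{3/2}_loc(ℝ³ × [0, ∞))` of Kang–Miura–Tsai 2021, Def. 3.1/3.2, on a set of finite
measure. [cite: KangMiuraTsai2020, Def. 3.1 (1)] -/
theorem integrableOn_block_zero (h : IsLocalLeraySolution ν v₀ v π) {b : ℝ} (hb : 0 < b)
    {K : Set (EuclideanSpace ℝ (Fin 3))} (hK : IsCompact K) :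
    IntegrableOn (uncurry v) (Ioo 0 b ×ˢ K) volume ∧
      IntegrableOn (fun z => ‖uncurry v z‖ ^ 2) (Ioo 0 b ×ˢ K) volume ∧
      IntegrableOn (uncurry π) (Ioo 0 b ×ˢ K) volume := by
  obtain ⟨hvm, hπm⟩ := h.aestronglyMeasurable_block b K
  obtain ⟨h1, h2⟩ := integrableOn_cylinder_of_lintegral_sq hK hvm (h.sqIntegrable b hb K hK)
  refine ⟨h1, h2, ?_⟩
  -- the pressure: `L^{3/2}` of a set of finite measure
  haveI : IsFiniteMeasure ((volume : Measure (ℝ × (EuclideanSpace ℝ (Fin 3)))).restrict (Ioo 0 b ×ˢ K)) :=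
    ⟨by rw [Measure.restrict_apply_univ]; exact volume_Ioo_prod_lt_top hK⟩
  have h32 : (3 / 2 : ℝ≥0∞) = ENNReal.ofReal (3 / 2) := by
    rw [ENNReal.ofReal_div_of_pos (by norm_num)]; simp
  have hmem : MemLp (uncurry π) (3 / 2 : ℝ≥0∞) (volume.restrict (Ioo 0 b ×ˢ K)) := by
    refine ⟨hπm, ?_⟩
    rw [eLpNorm_lt_top_iff_lintegral_rpow_enorm_lt_top (by norm_num) (by rw [h32]; simp)]
    rw [h32, ENNReal.toReal_ofReal (by norm_num)]
    simpa [uncurry] using h.pressure b hb K hK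
  exact hmem.integrable (by rw [h32]; exact ENNReal.one_le_ofReal.2 (by norm_num))

/-! #### `|v|^{10/3}` and `|v|³` on blocks -/

/-- **`v ∈ L^{10/3}((0, T) × K)` up to `t = 0`** for a local Leray solution and a compact `K`
(Lemarié-Rieusset 2016, (13.18), applied on a cylinder `(0, R²) × B_R ⊇ (0, T) × K` with the
uniformly local energy bounds (2) of Kang–Miura–Tsai 2021, Def. 3.1, which hold up to `t = 0`). [cite: LemarieRieusset2016, (13.18) p. 461] -/
theorem lintegral_rpow_ten_thirds_block_lt_top (h : IsLocalLeraySolution ν v₀ v π) {T : ℝ}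
    (hT : 0 < T) {K : Set (EuclideanSpace ℝ (Fin 3))} (hK : IsCompact K) :
    ∫⁻ z in Ioo 0 T ×ˢ K, ‖v z.1 z.2‖ₑ ^ (10 / 3 : ℝ) < ∞ := by
  obtain ⟨r, hr⟩ := hK.isBounded.subset_ball (0 : (EuclideanSpace ℝ (Fin 3)))
  set R : ℝ := max r 0 + T + 1 with hR
  have hR0 : 0 < R := by rw [hR]; linarith [le_max_right r 0]
  have hR1 : 1 ≤ R := by rw [hR]; linarith [le_max_right r 0]
  have hTR : T ≤ R ^ 2 := by rw [hR]; nlinarith [le_max_right r 0]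
  have hrR : r ≤ R := by rw [hR]; linarith [le_max_left r 0]
  obtain ⟨CE, hCE⟩ := h.uniformLocalEnergy R hR0
  obtain ⟨G, hG, hGR⟩ := h.uniformLocalGradient
  obtain ⟨CG, hCG⟩ := hGR R hR0
  set Ω : Opens (ℝ × (EuclideanSpace ℝ (Fin 3))) := timeCylinder ⟨ball (0 : (EuclideanSpace ℝ (Fin 3))) R, isOpen_ball⟩ 0 (R ^ 2) with hΩ
  have hΩcoe : ((Ω : Opens (ℝ × (EuclideanSpace ℝ (Fin 3)))) : Set (ℝ × (EuclideanSpace ℝ (Fin 3)))) = Ioo 0 (R ^ 2) ×ˢ ball (0 : (EuclideanSpace ℝ (Fin 3))) R := rfl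
  have hΩslab : Ω ≤ slab (EuclideanSpace ℝ (Fin 3)) (Ioi 0) isOpen_Ioi := fun z hz => mem_slab.2 hz.1.1
  -- the energy hypothesis in indicator form
  have hE : ∃ C : ℝ≥0, ∀ᵐ t : ℝ, ∫⁻ x, ((Ω : Opens (ℝ × (EuclideanSpace ℝ (Fin 3)))) : Set (ℝ × (EuclideanSpace ℝ (Fin 3)))).indicator
      (fun z : ℝ × (EuclideanSpace ℝ (Fin 3)) => ‖v z.1 z.2‖ₑ ^ 2) (t, x) ≤ C := by
    refine ⟨CE, ?_⟩
    have hCE' := (ae_restrict_iff' (measurableSet_Ioo (a := (0 : ℝ)) (b := R ^ 2))).1 hCE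
    filter_upwards [hCE'] with t ht
    by_cases htI : t ∈ Ioo 0 (R ^ 2)
    · have e1 : (fun x => ((Ω : Opens (ℝ × (EuclideanSpace ℝ (Fin 3)))) : Set (ℝ × (EuclideanSpace ℝ (Fin 3)))).indicator
          (fun z : ℝ × (EuclideanSpace ℝ (Fin 3)) => ‖v z.1 z.2‖ₑ ^ 2) (t, x)) =
          (ball (0 : (EuclideanSpace ℝ (Fin 3))) R).indicator (fun x => ‖v t x‖ₑ ^ 2) := by
        funext x
        rw [hΩcoe]
        by_cases hx : x ∈ ball (0 : (EuclideanSpace ℝ (Fin 3))) R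
        · rw [indicator_of_mem (mk_mem_prod htI hx), indicator_of_mem hx]
        · rw [indicator_of_notMem (fun h' => hx h'.2), indicator_of_notMem hx]
      rw [e1, lintegral_indicator measurableSet_ball]
      exact ht htI 0
    · have e1 : (fun x => ((Ω : Opens (ℝ × (EuclideanSpace ℝ (Fin 3)))) : Set (ℝ × (EuclideanSpace ℝ (Fin 3)))).indicator
          (fun z : ℝ × (EuclideanSpace ℝ (Fin 3)) => ‖v z.1 z.2‖ₑ ^ 2) (t, x)) = fun _ => 0 := by
        funext x
        rw [hΩcoe, indicator_of_notMem (fun h' => htI h'.1)]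
      rw [e1, lintegral_zero]
      exact bot_le
  have hGΩ : HasWeakSpatialGradientOn Ω v G := hG.mono hΩslab
  have hGsq : ∫⁻ z in ((Ω : Opens (ℝ × (EuclideanSpace ℝ (Fin 3)))) : Set (ℝ × (EuclideanSpace ℝ (Fin 3)))),
      ENNReal.ofReal (frobeniusNormSq (G z.1 z.2)) < ∞ := by
    rw [hΩcoe]
    exact (hCG 0).trans_lt ENNReal.coe_lt_top
  have hsub : Ioo 0 T ×ˢ ball (0 : (EuclideanSpace ℝ (Fin 3))) R ⊆ ((Ω : Opens (ℝ × (EuclideanSpace ℝ (Fin 3)))) : Set (ℝ × (EuclideanSpace ℝ (Fin 3)))) := by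
    rw [hΩcoe]
    exact prod_mono (Ioo_subset_Ioo_right hTR) Subset.rfl
  have key := lintegral_rpow_ten_thirds_lt_top_of_energy finrank_euclideanSpace_fin hE hGΩ hGsq hsub
  exact lt_of_le_of_lt (lintegral_mono_set (prod_mono Subset.rfl (hr.trans (ball_subset_ball hrR))))
    key

/-- `x³ ≤ 1 + x^{10/3}` in `ℝ≥0∞`. [folklore] -/
theorem pow_three_le_one_add_rpow (x : ℝ≥0∞) : x ^ (3 : ℕ) ≤ 1 + x ^ (10 / 3 : ℝ) := by
  rcases le_or_gt x 1 with hx | hx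
  · calc x ^ (3 : ℕ) ≤ 1 ^ (3 : ℕ) := by gcongr
      _ = 1 := one_pow 3
      _ ≤ 1 + x ^ (10 / 3 : ℝ) := le_self_add
  · calc x ^ (3 : ℕ) = x ^ ((3 : ℕ) : ℝ) := (ENNReal.rpow_natCast x 3).symm
      _ ≤ x ^ (10 / 3 : ℝ) := ENNReal.rpow_le_rpow_of_exponent_le hx.le (by norm_num)
      _ ≤ 1 + x ^ (10 / 3 : ℝ) := le_add_self

/-- **`v ∈ L³((0, T) × K)` up to `t = 0`** for a local Leray solution and a compact `K`
(`|v|³ ≤ 1 + |v|^{10/3}` and `lintegral_rpow_ten_thirds_block_lt_top`). [cite: LemarieRieusset2016, (13.18) p. 461] -/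
theorem lintegral_cube_block_lt_top (h : IsLocalLeraySolution ν v₀ v π) {T : ℝ} (hT : 0 < T)
    {K : Set (EuclideanSpace ℝ (Fin 3))} (hK : IsCompact K) :
    ∫⁻ z in Ioo 0 T ×ˢ K, ‖v z.1 z.2‖ₑ ^ (3 : ℕ) < ∞ := by
  have h103 := h.lintegral_rpow_ten_thirds_block_lt_top hT hK
  calc ∫⁻ z in Ioo 0 T ×ˢ K, ‖v z.1 z.2‖ₑ ^ (3 : ℕ)
      ≤ ∫⁻ z in Ioo 0 T ×ˢ K, (1 + ‖v z.1 z.2‖ₑ ^ (10 / 3 : ℝ)) :=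
        lintegral_mono fun z => pow_three_le_one_add_rpow _
    _ = (volume : Measure (ℝ × (EuclideanSpace ℝ (Fin 3)))) (Ioo 0 T ×ˢ K) +
          ∫⁻ z in Ioo 0 T ×ˢ K, ‖v z.1 z.2‖ₑ ^ (10 / 3 : ℝ) := by
        rw [lintegral_add_left' aemeasurable_const, lintegral_const, Measure.restrict_apply_univ,
          one_mul]
    _ < ∞ := ENNReal.add_lt_top.2 ⟨volume_Ioo_prod_lt_top hK, h103⟩

/-- **`|v|³` is integrable on the blocks `(0, b) × K` up to `t = 0`.** [cite: LemarieRieusset2016, (13.18) p. 461] -/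
theorem integrableOn_cube_block_zero (h : IsLocalLeraySolution ν v₀ v π) {b : ℝ} (hb : 0 < b)
    {K : Set (EuclideanSpace ℝ (Fin 3))} (hK : IsCompact K) :
    IntegrableOn (fun z : ℝ × (EuclideanSpace ℝ (Fin 3)) => ‖v z.1 z.2‖ ^ 3) (Ioo 0 b ×ˢ K) volume := by
  obtain ⟨hvm, -⟩ := h.aestronglyMeasurable_block b K
  refine ⟨(hvm.norm.pow 3 :), ?_⟩
  rw [hasFiniteIntegral_iff_enorm]
  refine lt_of_le_of_lt (lintegral_mono fun z => le_of_eq ?_) (h.lintegral_cube_block_lt_top hb hK)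
  rw [Real.enorm_eq_ofReal (by positivity), ENNReal.ofReal_pow (norm_nonneg _), ofReal_norm]

/-- **`|v|³ ∈ L¹_loc` of the open slab `(0, ∞) × ℝ³`** for a local Leray solution: every compact
subset of the slab lies in a block `(0, b) × K`. This is the hypothesis `hu3` of the tree's
sliced local energy inequality `IsSuitableWeakSolutionOn.ae_localEnergy_slice`. [cite: LemarieRieusset2016, (13.18) p. 461] -/
theorem locallyIntegrableOn_cube (h : IsLocalLeraySolution ν v₀ v π) :
    LocallyIntegrableOn (fun z : ℝ × (EuclideanSpace ℝ (Fin 3)) => ‖v z.1 z.2‖ ^ 3)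
      ((slab (EuclideanSpace ℝ (Fin 3)) (Ioi 0) isOpen_Ioi : Opens (ℝ × (EuclideanSpace ℝ (Fin 3)))) : Set (ℝ × (EuclideanSpace ℝ (Fin 3)))) volume := by
  refine (locallyIntegrableOn_iff (Opens.isOpen _).isLocallyClosed).2 fun K' hK' hK'c => ?_
  rcases K'.eq_empty_or_nonempty with hemp | hne
  · rw [hemp]; exact integrableOn_empty
  have h1c : IsCompact (Prod.fst '' K') := hK'c.image continuous_fst
  have h2c : IsCompact (Prod.snd '' K') := hK'c.image continuous_snd
  obtain ⟨b, hb⟩ := h1c.bddAbove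
  obtain ⟨z₀, hz₀⟩ := hne
  have hz₀t : 0 < z₀.1 := mem_slab.1 (hK' hz₀)
  have hb0 : 0 < b + 1 := by
    have : z₀.1 ≤ b := hb (mem_image_of_mem _ hz₀)
    linarith
  have hsub : K' ⊆ Ioo 0 (b + 1) ×ˢ (Prod.snd '' K') := fun z hz =>
    ⟨⟨mem_slab.1 (hK' hz), lt_of_le_of_lt (hb (mem_image_of_mem _ hz)) (lt_add_one b)⟩,
      mem_image_of_mem _ hz⟩
  exact (h.integrableOn_cube_block_zero hb0 h2c).mono_set hsub

/-- `|π|^{3/2}` is integrable on the blocks `(0, b) × K` up to `t = 0` (the clause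
`π ∈ L^{3/2}_loc(ℝ³ × [0, ∞))` with the measurability of `π`). [cite: KangMiuraTsai2020, Def. 3.1 (1)] -/
theorem integrableOn_abs_pressure_rpow_block_zero (h : IsLocalLeraySolution ν v₀ v π) {b : ℝ}
    (hb : 0 < b) {K : Set (EuclideanSpace ℝ (Fin 3))} (hK : IsCompact K) :
    IntegrableOn (fun z : ℝ × (EuclideanSpace ℝ (Fin 3)) => |π z.1 z.2| ^ (3 / 2 : ℝ)) (Ioo 0 b ×ˢ K) volume := by
  obtain ⟨-, hπm⟩ := h.aestronglyMeasurable_block b K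
  have hm : AEStronglyMeasurable (fun z : ℝ × (EuclideanSpace ℝ (Fin 3)) => |π z.1 z.2| ^ (3 / 2 : ℝ))
      (volume.restrict (Ioo 0 b ×ˢ K)) := by
    have e : (fun z : ℝ × (EuclideanSpace ℝ (Fin 3)) => |π z.1 z.2| ^ (3 / 2 : ℝ)) = fun z => ‖uncurry π z‖ ^ (3 / 2 : ℝ) := by
      funext z; rw [Real.norm_eq_abs]; rfl
    rw [e]
    exact (hπm.aemeasurable.norm.pow_const _).aestronglyMeasurable
  refine ⟨hm, ?_⟩
  rw [hasFiniteIntegral_iff_enorm]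
  refine lt_of_le_of_lt (lintegral_mono fun z => le_of_eq ?_) (h.pressure b hb K hK)
  rw [Real.enorm_eq_ofReal (Real.rpow_nonneg (abs_nonneg _) _), Real.enorm_eq_ofReal_abs,
    ENNReal.ofReal_rpow_of_nonneg (abs_nonneg _) (by norm_num)]

/-- **The flux `(|v|² + 2π) v` is integrable on the blocks `(0, b) × K` up to `t = 0`**
(Young: `|π| |v| ≤ (2/3)|π|^{3/2} + (1/3)|v|³`). [cite: LemarieRieusset2016, Prop. 14.1 (proof)] -/
theorem integrableOn_cubicFlux_block_zero (h : IsLocalLeraySolution ν v₀ v π) {b : ℝ}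
    (hb : 0 < b) {K : Set (EuclideanSpace ℝ (Fin 3))} (hK : IsCompact K) :
    IntegrableOn (uncurry fun t x => (‖v t x‖ ^ 2 + 2 * π t x) • v t x) (Ioo 0 b ×ˢ K) volume := by
  obtain ⟨hu, -, hp⟩ := h.integrableOn_block_zero hb hK
  have hu3K := h.integrableOn_cube_block_zero hb hK
  have hp32 := h.integrableOn_abs_pressure_rpow_block_zero hb hK
  -- measurability
  have hm : AEStronglyMeasurable (uncurry fun t x => (‖v t x‖ ^ 2 + 2 * π t x) • v t x)
      (volume.restrict (Ioo 0 b ×ˢ K)) := by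
    have e : (uncurry fun t x => (‖v t x‖ ^ 2 + 2 * π t x) • v t x) =
        fun z : ℝ × (EuclideanSpace ℝ (Fin 3)) => (‖uncurry v z‖ ^ 2 + 2 * uncurry π z) • uncurry v z := by
      funext z; rfl
    rw [e]
    exact ((hu.aestronglyMeasurable.norm.pow 2).add
      (hp.aestronglyMeasurable.const_mul 2)).smul hu.aestronglyMeasurable
  -- domination by `(5/3)|v|³ + (4/3)|π|^{3/2}`
  refine Integrable.mono' ((hu3K.const_mul (5 / 3)).add (hp32.const_mul (4 / 3))) hm
    (Eventually.of_forall fun z => ?_)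
  have hpq : (3 / 2 : ℝ).HolderConjugate 3 := Real.holderConjugate_iff.2 ⟨by norm_num, by norm_num⟩
  have hy := Real.young_inequality_of_nonneg (abs_nonneg (π z.1 z.2)) (norm_nonneg (v z.1 z.2)) hpq
  simp only [uncurry, norm_smul, Real.norm_eq_abs, Pi.add_apply]
  have h3 : ‖v z.1 z.2‖ ^ (3 : ℝ) = ‖v z.1 z.2‖ ^ 3 := by
    rw [show (3 : ℝ) = ((3 : ℕ) : ℝ) by norm_num, Real.rpow_natCast]
  rw [h3] at hy
  have hu0 := norm_nonneg (v z.1 z.2)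
  calc |‖v z.1 z.2‖ ^ 2 + 2 * π z.1 z.2| * ‖v z.1 z.2‖
      ≤ (‖v z.1 z.2‖ ^ 2 + 2 * |π z.1 z.2|) * ‖v z.1 z.2‖ := by
        gcongr
        exact (abs_add_le _ _).trans (by rw [abs_of_nonneg (sq_nonneg _), abs_mul, abs_two])
    _ = ‖v z.1 z.2‖ ^ 3 + 2 * (|π z.1 z.2| * ‖v z.1 z.2‖) := by ring
    _ ≤ ‖v z.1 z.2‖ ^ 3 + 2 * (|π z.1 z.2| ^ (3 / 2 : ℝ) / (3 / 2) + ‖v z.1 z.2‖ ^ 3 / 3) := by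
        gcongr
    _ = 5 / 3 * ‖v z.1 z.2‖ ^ 3 + 4 / 3 * |π z.1 z.2| ^ (3 / 2 : ℝ) := by ring

end IsLocalLeraySolution

end Literature.Analysis.FluidPDE
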